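import Literature.Computability.QuantumComplexity.JonesStrandDeletion
import HarnessLib

/-!
# Compressing a braid word onto few strands (classical preprocessing of the AJL problem)

Topic `Literature/Computability/QuantumComplexity`; a step in the discharge of
`ajl_jonesApproxProblem_mem_PromiseBQP`. The instances of `jonesApproxProblem` carry the strand
number `n` in binary, so a polynomial-time digest cannot lay out `n` strands; but a pair of strands
`2l, 2l+1` touched by no crossing is a separate unknotted circle of the plat closure and can be
deleted without changing the normalised Jones quantity (`ajlRatio_eq_ajlRatio_compressWord`,
`JonesStrandDeletion.lean`). Here we iterate this on *raw* words (lists of `(index, sign)` with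
`ℕ` indices, `toFin` turning them into braid words): `delPair` deletes one free pair and re-indexes,
`compressRaw` deletes free pairs while at least four strands remain, and `compressRaw_spec` records
that the result has an even number `≥ 2` of strands, in-range indices, and the same `ajlRatio` at the
fifth root of unity. (Every crossing blocks at most two pairs, so the compressed strand number is at
most `4·|word| + 3`; this bound is not needed here.)

## References

* D. Aharonov, V. Jones, Z. Landau, Algorithmica 55 (2009), Thm. 3.2 (the plat-closure quantity as
  a matrix element; unlinked circles contribute the loop value) [AharonovJonesLandau2009].
* L. H. Kauffman, Topology 26 (1987), `⟨L ⊔ ◯⟩ = d⟨L⟩` [Kauffman1987].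
-/

noncomputable section

namespace Literature.Computability.QuantumComplexity

namespace AJLCore

/-! ### Raw words -/

/-- The raw form of a braid word: `ℕ` indices. [folklore] -/
def rawOf {n : ℕ} (b : BraidWord n) : List (ℕ × Bool) := b.map fun g => ((g.1 : ℕ), g.2)

/-- A raw word read as a braid word on `n` strands (out-of-range letters dropped, as in
`RawJonesInstance.toBraidWord`). [folklore] -/
def toFin (n : ℕ) (w : List (ℕ × Bool)) : BraidWord n :=
  w.filterMap fun g => if h : g.1 < n - 1 then some (⟨g.1, h⟩, g.2) else none

/-- `toFin ∘ rawOf = id`. [folklore] -/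
theorem toFin_rawOf {n : ℕ} (b : BraidWord n) : toFin n (rawOf b) = b := by
  unfold toFin rawOf
  rw [List.filterMap_map]
  conv_rhs => rw [← List.filterMap_some (l := b)]
  refine List.filterMap_congr fun g _ => ?_
  simp only [Function.comp_apply, dif_pos g.1.2]

/-- `rawOf ∘ toFin = id` on in-range words. [folklore] -/
theorem rawOf_toFin {n : ℕ} (w : List (ℕ × Bool)) (hw : ∀ g ∈ w, g.1 < n - 1) : rawOf (toFin n w) = w := by
  unfold toFin rawOf
  rw [List.map_filterMap]
  conv_rhs => rw [← List.filterMap_some (l := w)]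
  refine List.filterMap_congr fun g hg => ?_
  simp only [dif_pos (hw g hg), Option.map_some]

/-- The instance's braid word, raw. [folklore] -/
theorem toFin_rawOf_toBraidWord (x : RawJonesInstance) : toFin x.1 (rawOf x.toBraidWord) = x.toBraidWord := toFin_rawOf _

/-- Raw letters of a braid word are in range. [folklore] -/
theorem rawOf_lt {n : ℕ} (b : BraidWord n) : ∀ g ∈ rawOf b, g.1 < n - 1 := by
  intro g hg; unfold rawOf at hg; rw [List.mem_map] at hg; obtain ⟨g', -, rfl⟩ := hg; exact g'.1.2

/-! ### Deleting one free pair -/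

/-- The pair `2l, 2l+1` is free: no crossing touches it. [folklore] -/
def Free (w : List (ℕ × Bool)) (l : ℕ) : Prop := ∀ g ∈ w, g.1 + 1 ≠ 2 * l ∧ g.1 ≠ 2 * l ∧ g.1 ≠ 2 * l + 1

/-- Freeness is decidable. [folklore] -/
instance (w : List (ℕ × Bool)) (l : ℕ) : Decidable (Free w l) := by unfold Free; infer_instance

/-- Delete the pair `2l, 2l+1` and re-index. [folklore] -/
def delPair (l : ℕ) (w : List (ℕ × Bool)) : List (ℕ × Bool) := w.map fun g => (if g.1 < 2 * l then g.1 else g.1 - 2, g.2)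

/-- `delPair` is `compressWord` on raw words. [folklore] -/
theorem rawOf_compressWord {m l : ℕ} (h2 : 2 ≤ m) (hl : 2 * l ≤ m) (c : BraidWord (m + 2)) (hc : Free (rawOf c) l) :
    rawOf (compressWord h2 l c) = delPair l (rawOf c) := by
  unfold rawOf compressWord delPair
  rw [List.map_map, List.map_map]
  refine List.map_congr_left fun g hg => ?_
  have hfree := hc ((g.1 : ℕ), g.2) (List.mem_map.2 ⟨g, hg, rfl⟩)
  have hglt := g.1.2
  simp only [Function.comp_apply, compressGen, compressIdx, Prod.mk.injEq, and_true]
  split_ifs with h <;> omega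

/-- Indices after deleting a free pair stay in range. [folklore] -/
theorem delPair_lt {m l : ℕ} (hl : 2 * l ≤ m) (w : List (ℕ × Bool)) (hw : ∀ g ∈ w, g.1 < m + 1) (hfree : Free w l) :
    ∀ g ∈ delPair l w, g.1 < m - 1 := by
  intro g hg
  unfold delPair at hg; rw [List.mem_map] at hg
  obtain ⟨g', hg', rfl⟩ := hg
  have h1 := hw g' hg'; have h2 := hfree g' hg'
  simp only
  split_ifs with h <;> omega

/-- **One deletion keeps the normalised Jones quantity.** [cite: AharonovJonesLandau2009, Thm. 3.2] [cite: Kauffman1987, (⟨L ⊔ ◯⟩ = d⟨L⟩)] -/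
theorem ajlRatio_delPair {m l : ℕ} (hm : Even m) (h2 : 2 ≤ m) (hl : 2 * l ≤ m) (w : List (ℕ × Bool)) (hw : ∀ g ∈ w, g.1 < m + 1)
    (hfree : Free w l) : ajlRatio 5 (m + 2) (toFin (m + 2) w) = ajlRatio 5 m (toFin m (delPair l w)) := by
  have hraw : rawOf (toFin (m + 2) w) = w := rawOf_toFin w (fun g hg => by have := hw g hg; omega)
  have hc : Free (rawOf (toFin (m + 2) w)) l := by rw [hraw]; exact hfree
  rw [ajlRatio_eq_ajlRatio_compressWord hl h2 hm (toFin (m + 2) w) (fun g hg => hc ((g.1 : ℕ), g.2) (List.mem_map.2 ⟨g, hg, rfl⟩))]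
  congr 1
  rw [← toFin_rawOf (compressWord h2 l (toFin (m + 2) w)), rawOf_compressWord h2 hl _ hc, hraw]

/-! ### Iterated deletion -/

/-- The largest free pair among the pairs of a braid on `m + 2` strands (`l ≤ m/2`), if any. [folklore] -/
def findFree (m : ℕ) (w : List (ℕ × Bool)) : Option ℕ := ((List.range (m / 2 + 1)).reverse).find? fun l => decide (Free w l)

/-- A found pair is free and in range. [folklore] -/
theorem findFree_spec {m : ℕ} {w : List (ℕ × Bool)} {l : ℕ} (h : findFree m w = some l) : Free w l ∧ 2 * l ≤ m := by
  unfold findFree at h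
  have h1 := List.find?_some h
  have h2 := List.mem_of_find?_eq_some h
  rw [List.mem_reverse, List.mem_range] at h2
  exact ⟨of_decide_eq_true h1, by omega⟩

/-- **Compression with fuel**: while at least four strands remain and a pair is free, delete the
largest free pair. [folklore] -/
def compressFuel : ℕ → ℕ → List (ℕ × Bool) → ℕ × List (ℕ × Bool)
  | 0, n, w => (n, w)
  | f + 1, n, w =>
    if 4 ≤ n then
      match findFree (n - 2) w with
      | some l => compressFuel f (n - 2) (delPair l w)
      | none => (n, w)
    else (n, w)

/-- **The compressed form of a braid word** (strand number and raw word). [folklore] -/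
def compressRaw (n : ℕ) (w : List (ℕ × Bool)) : ℕ × List (ℕ × Bool) := compressFuel (n / 2) n w

/-- The invariant of the compression. [cite: AharonovJonesLandau2009, Thm. 3.2] -/
theorem compressFuel_spec : ∀ (f n : ℕ) (w : List (ℕ × Bool)), Even n → 2 ≤ n → (∀ g ∈ w, g.1 < n - 1) →
    Even (compressFuel f n w).1 ∧ 2 ≤ (compressFuel f n w).1 ∧ (∀ g ∈ (compressFuel f n w).2, g.1 < (compressFuel f n w).1 - 1) ∧
      ajlRatio 5 (compressFuel f n w).1 (toFin (compressFuel f n w).1 (compressFuel f n w).2) = ajlRatio 5 n (toFin n w)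
  | 0, n, w, hn, h2, hw => ⟨hn, h2, hw, rfl⟩
  | f + 1, n, w, hn, h2, hw => by
    by_cases h4 : 4 ≤ n
    · cases hfind : findFree (n - 2) w with
      | none =>
        have e : compressFuel (f + 1) n w = (n, w) := by simp [compressFuel, h4, hfind]
        rw [e]; exact ⟨hn, h2, hw, rfl⟩
      | some l =>
        have e : compressFuel (f + 1) n w = compressFuel f (n - 2) (delPair l w) := by simp [compressFuel, h4, hfind]
        rw [e]
        obtain ⟨m, rfl⟩ : ∃ m, n = m + 2 := ⟨n - 2, by omega⟩
        simp only [Nat.add_sub_cancel] at hfind ⊢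
        obtain ⟨hfree, hl⟩ := findFree_spec hfind
        have hm : Even m := by obtain ⟨a, ha⟩ := hn; exact ⟨a - 1, by omega⟩
        have hm2 : 2 ≤ m := by omega
        have hw' : ∀ g ∈ w, g.1 < m + 1 := fun g hg => by have := hw g hg; omega
        obtain ⟨e1, e2, e3, e4⟩ := compressFuel_spec f m (delPair l w) hm hm2 (delPair_lt hl w hw' hfree)
        exact ⟨e1, e2, e3, e4.trans (ajlRatio_delPair hm hm2 hl w hw' hfree).symm⟩
    · have e : compressFuel (f + 1) n w = (n, w) := by simp [compressFuel, h4]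
      rw [e]; exact ⟨hn, h2, hw, rfl⟩

/-- **The compressed braid has an even number `≥ 2` of strands, in-range letters, and the same
normalised Jones quantity.** [cite: AharonovJonesLandau2009, Thm. 3.2] [cite: Kauffman1987, (⟨L ⊔ ◯⟩ = d⟨L⟩)] -/
theorem compressRaw_spec {n : ℕ} (hn : Even n) (h2 : 2 ≤ n) (w : List (ℕ × Bool)) (hw : ∀ g ∈ w, g.1 < n - 1) :
    Even (compressRaw n w).1 ∧ 2 ≤ (compressRaw n w).1 ∧ (∀ g ∈ (compressRaw n w).2, g.1 < (compressRaw n w).1 - 1) ∧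
      ajlRatio 5 (compressRaw n w).1 (toFin (compressRaw n w).1 (compressRaw n w).2) = ajlRatio 5 n (toFin n w) :=
  compressFuel_spec _ n w hn h2 hw

/-- **The compressed instance word has the instance's normalised Jones quantity** (valid instances).
[cite: AharonovJonesLandau2009, Thm. 3.2] -/
theorem ajlRatio_compressRaw (x : RawJonesInstance) (hx : x.IsValid) :
    ajlRatio 5 (compressRaw x.1 (rawOf x.toBraidWord)).1 (toFin _ (compressRaw x.1 (rawOf x.toBraidWord)).2) = ajlRatio 5 x.1 x.toBraidWord := by
  rw [(compressRaw_spec hx.1 hx.2.1 _ (rawOf_lt _)).2.2.2, toFin_rawOf_toBraidWord]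

end AJLCore

end Literature.Computability.QuantumComplexity

end
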